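import Summits.CriticalPhenomena.PercolationContinuityZ3.Theorems.Transplant.SiteThetaContinuousRowsII
import Summits.CriticalPhenomena.PercolationContinuityZ3.Theorems.TransplantHeisenbergAmenable
import Summits.CriticalPhenomena.PercolationContinuityZ3.Theorems.TransplantHeisenbergConnected
import Literature.Probability.Percolation.CoveringTameFibres
import HarnessLib

/-!
# The SITE continuity column for the covering graph of the Heisenberg Cayley graph `Cay(H₃(ℤ); a^{±1}, b^{±1})`:
# `p ↦ θ^{site}(e, p)` is continuous on `[0, 1]` at every vertex `e` of `L(Cay(H₃(ℤ)))`

builds on p205010 (kernel theorem, internal audit signed; external expert review pending) — only through the row's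
`θ^{site}(p_c^{site}) = 0` theorem (`heisenbergLineGraph_siteCriticalContinuity`, gen 13, via the skeleton node).
Lane `prim-bschramm`, seat `prim-bschramm-p2` (gen 18; class C1b by INPUT SUBSTITUTION); helper file
(`--supports stmt-CriticalPhenomena-4575`).  Memo `HOME/bschramm/P2-LATTICES.md` §46.

THE ONE MISSING INPUT (gen 17 HANDOFF: "L(H₃(ℤ)): ballVolume bound only at the origin in `TransplantHeisenbergAmenable`; needs a
translation-to-every-vertex lemma, then one line"): the polynomial growth bound `|B(y, n)| ≤ (2n+1)²(2n²+1) ≤ 27 (n+1)⁴` at EVERY vertex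
`y`, obtained from the origin bound `ballVolume_heis_le` by the left translations `heisLeftIso y` (automorphisms of the right Cayley graph,
`heisLeftIso y 0 = y`) and automorphism invariance of ball volumes (`ballVolume_map_eq`).  Then gen 17's generic
`continuous_siteTheta_lineGraph_of_polyGrowth` (site van den Berg–Keane on the covering lattice of any connected quasi-transitive graph of
polynomial growth, given `θ^{site}(p_c^{site}) = 0`) applies verbatim.
* `ballVolume_heis_le_all` (every vertex), `ballVolume_heis_le_poly` (`≤ 27 (n+1)⁴` in `ℝ`);
* **`continuous_siteTheta_heisenbergLineGraph`** — the continuity cell of the row `L(H₃(ℤ))` (was OPEN-trivial in TABLE v27, §45).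
PLACEMENT: a corollary (van den Berg–Keane's criterion, site reading, on a graph of polynomial growth of degree 4); not in print as such.
[cite: VandenBergKeane1984, main theorem] [cite: BenjaminiSchramm1996, Conj. 4] [cite: LyonsPeres2016, §6.1 (p. 279)]
-/

noncomputable section

namespace Summit.CriticalPhenomena.PercolationContinuityZ3.Theorems.Transplant

namespace SiteThetaContRows

open MeasureTheory Literature.Probability.Percolation Literature.Probability.LatticeModels SimpleGraph Filter
open Literature.Barriers.CriticalPhenomena SiteThetaContGraph SiteUniqQT LineGraphGrowth
open scoped Classical Topology

/-- **Polynomial growth of `Cay(H₃(ℤ))` at EVERY vertex**: `|B(y, n)| ≤ (2n+1)²(2n²+1)` — the origin bound `ballVolume_heis_le` transported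
by the left translation `heisLeftIso y` (`ballVolume_map_eq`). [cite: LyonsPeres2016, §6.1 (p. 279)] -/
theorem ballVolume_heis_le_all (y : Heisenberg.HV) (n : ℕ) :
    ballVolume Heisenberg.heisenbergGraph y n ≤ (2 * n + 1) * (2 * n + 1) * (2 * n ^ 2 + 1) := by
  have hy : Heisenberg.heisLeftIso y 0 = y := by
    show Heisenberg.heisMul y 0 = y
    exact Heisenberg.heisMul_zero y
  have h := ballVolume_map_eq (Heisenberg.heisLeftIso y) 0 n
  rw [hy] at h
  rw [h]
  exact Heisenberg.ballVolume_heis_le n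

/-- `|B(y, n)| ≤ 27 (n+1)⁴` in `ℝ`, every vertex `y` of `Cay(H₃(ℤ))`. [folklore] -/
theorem ballVolume_heis_le_poly (y : Heisenberg.HV) (n : ℕ) :
    (ballVolume Heisenberg.heisenbergGraph y n : ℝ) ≤ 27 * ((n : ℝ) + 1) ^ 4 := by
  have h1 := ballVolume_heis_le_all y n
  have h2 : ((2 * n + 1) * (2 * n + 1) * (2 * n ^ 2 + 1) : ℕ) ≤ 27 * (n + 1) ^ 4 := by
    have e : (2 * n + 1) * (2 * n + 1) * (2 * n ^ 2 + 1) = 8 * n ^ 4 + 8 * n ^ 3 + 6 * n ^ 2 + 4 * n + 1 := by ring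
    have e' : 27 * (n + 1) ^ 4 = 27 * n ^ 4 + 108 * n ^ 3 + 162 * n ^ 2 + 108 * n + 27 := by ring
    rw [e, e']
    omega
  have h3 : (ballVolume Heisenberg.heisenbergGraph y n : ℝ) ≤ ((27 * (n + 1) ^ 4 : ℕ) : ℝ) := by exact_mod_cast h1.trans h2
  refine h3.trans (le_of_eq ?_)
  push_cast
  ring

/-- **`p ↦ θ^{site}(e, p)` is continuous on `[0, 1]` at every site `e` of the covering graph `L(Cay(H₃(ℤ)))` of the Heisenberg Cayley graph**
(site van den Berg–Keane on the line graph of a connected quasi-transitive graph of polynomial growth, `continuous_siteTheta_lineGraph_of_polyGrowth`,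
fed with `ballVolume_heis_le_poly` and gen 13's `heisenbergLineGraph_siteCriticalContinuity`).  builds on p205010 (kernel theorem, internal audit
signed; external expert review pending). [cite: VandenBergKeane1984, main theorem] [cite: BenjaminiSchramm1996, Conj. 4] -/
theorem continuous_siteTheta_heisenbergLineGraph (e : Heisenberg.heisenbergGraph.edgeSet) :
    Continuous fun p : unitInterval => siteTheta Heisenberg.heisenbergGraph.lineGraph e p :=
  continuous_siteTheta_lineGraph_of_polyGrowth Heisenberg.heisenbergGraph_connected Heisenberg.heisenbergGraph_quasiTransitive
    (C := 27) (D := 4) ballVolume_heis_le_poly e (heisenbergLineGraph_siteCriticalContinuity e)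

end SiteThetaContRows

end Summit.CriticalPhenomena.PercolationContinuityZ3.Theorems.Transplant

end
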